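import Literature.MathematicalPhysics.QuantumFieldTheory.Balaban1983to89.B6Prop26HolderDivKLevelV1
import Literature.MathematicalPhysics.QuantumFieldTheory.Balaban1983to89.B6HolderPairPlacementV1
import Literature.MathematicalPhysics.QuantumFieldTheory.Balaban1983to89.B6HBDisplacementLipV1

/-!
# `Balaban1983to89.B6Prop26HolderDivAdmissibleV1` — T. Bałaban, *Propagators and renormalization transformations for lattice gauge theories. II*,
# Commun. Math. Phys. **96** (1984) 223–250 [Balaban1984PropagatorsII], Prop. 2.6 p. 247, THE HÖLDER ENTRY (2.137)₂ `‖ζG∇*J‖_α` AT k LEVELS FOR THE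
# GENUINE `G = Δ_a⁻¹` ON THE V1 TORUS, HYPOTHESIS-FREE FOR NEAR ADMISSIBLE PAIRS — the displayed inputs of `…B6Prop26HolderDivKLevelV1` discharged by
# the window geometry (p22 g26's `pair_window`, this seat's placement and cube pair lemmas, p22's displacement Lipschitz bound of `h_□`)

statement-level skeleton of published theorems with citation tags; proofs where landed; nothing here is a claim about the Yang–Mills mass gap

PDF held: `paper:balaban1984-cmp96-propagators-rt-ii` (journal page = PDF page + 222), p. 247 [PDF 25]: *"‖ζ∇GJ‖_α, ‖ζG∇*J‖_α ≤ O(1)(Lʲη)^{1−α}(‖ζ‖^ξ_α +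
|ζ|)e^{−δ₃d(y,y′)}|J|, ξ = L^{−j} (2.137) for 0 ≤ α < 1, ζ ∈ C₀^∞(Δ̃(y)) …, supp J ⊂ Δ(y′), with the constant O(1) depending on d, L and α (O(1) → ∞ if
α → 1)"*; *"Reasoning in the same way as in the proof of Proposition 2.2 we obtain Proposition 2.6"*; [4] (1.109) p. 35 (the Hölder quotient
`sup_{|x−x′|≤ξ} |f(x) − f(x′)|/|x − x′|^α`).

CITATION HEADER (lean-in-tree rule) — WHAT IS REPRODUCED.  Phase-2 file of the `lit-balaban` typed skeleton (HOME `run/shared/lean/pub/lit-balaban/`),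
seat **p38 gen 32/34** (free target (2.137)₂ at k levels, protocol G.5-34(d), TAKING HOME/STATUS.md 2026-08-23T22:54Z); SKELETON row **B6.Prop2.6**
(cells only; head and decls of record untouched, owner r03).  THE RESULT: for a NEAR ADMISSIBLE pair of fine bonds `(x, x′)` — same direction and
`|x − x′|_∞ ≤ L^{j(y(x))−2}`, `≤ L^{j(y(x′))−2}` (`t := |x − x′|_∞/L^{j(y(x))} ≤ L^{−2}`) — the Hölder quotient entry of `G∇*_ν` is bounded with NO
displayed hypothesis; the Lemma-2.1 exponent `α_W` of the walk (2.141) and the Hölder exponent `α` are SEPARATE parameters and the torus-size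
threshold is chosen BEFORE `α` (gen 34, so that the census shape of `…B6Prop26HolderDivCensusV1` — one rate, one threshold, then `∀ α ∃ A` — follows):
* **`prop26_2137_div_kLevel_near`** — there is `σ₀ > 0` such that for all `σ ∈ (0, σ₀]`, `α_W ∈ [0,1]`, `N₀ > 0`, `τ_b ∈ [0, 2σ]` there is `M₁ > 0`, and
  for every `α ∈ [0,1)` an `A ≥ 0`, with: on every admissible V1 torus above threshold (as `…B6Prop26HolderDivKLevelV1`), for every `c′ ≠ 0`, weights in
  the global band, `ν` and every near admissible pair: `HasMajorant (P_{x,x′}·G·∇*_ν) (A·t^α·(L^{j(y′)}|c′|⁻¹)·e^{−(1−α_W)σd_T(y,y′)})` — i.e. for `J`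
  supported in `B(y′)`: `|(G∇*_νJ)(x) − (G∇*_νJ)(x′)| ≤ A·(|x − x′|_∞/L^{j(y(x))})^α·L^{j(y′)}|c′|⁻¹·e^{−(1−α_W)σd_T(y(x),y′)}·|J|`, print's
  `O(1)(Lʲη)^{1−α}|x − x′|^α e^{−δ₃d}|J|` with `ξ = L^{−j}`, `η⁻¹ = |c′|`;
* **`prop26_2137_div_kLevel_near_out`** — the same with the prefactor `L·L^{j(y)}|c′|⁻¹` at the output block and rate `(1−α_W)σ − τ_b/2`.
THE DISCHARGES (per cube `□`, for the cubes with `h_□(x) ≠ 0` or `h_□(x′) ≠ 0`; the others contribute nothing): the pair lies `1`-deep in the window of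
`T_□` with member distance `≤ |x − x′|_∞ ≤ L^{j₀(□)}` (p22's `pair_window`; `j(y(x)) ≤ j₀ + 2` on `□⁺`), so this seat's `hHGout_cube`/`hHGEout_cube`
give the pair inputs with `τ = C_H·L²·t^α ≥ C_H·|x − x′|/L^{j₀}`, `τ_E = C_H·L²·t^α ≥ C_H(|x − x′|/L^{j₀})^α`; the placement `h_□(x′) ≠ 0 ⇒ y(x) ∈ □⁺` is
this seat's `blkV1_mem_ST_of_hB_ne_zero_of_supDist_le`; `|h_□(x) − h_□(x′)| ≤ (d+1)|x − x′|_∞C1F/(8S/5) ≤ (d+1)·C1F·t^α` is p22's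
`abs_hB_sub_le_supDist` (`S ≥ M_hL^{j(y(x))}` on `□⁺`).  IMPORTS BY NAME, restating nothing; THEOREMS ONLY (no `def`, no `def … : Prop`, no new
hypothesis); standard axioms.

HONEST SCOPE / DIVERGENCES.  (1) Print proves (2.137) by *"Reasoning in the same way as in the proof of Proposition 2.2"*; the two-sided walk and all
constants are OURS (HOME/GAPS.md G-B6-2137-2); no mathematical gap in the source is claimed.  (2) NEAR pairs only (`t ≤ L^{−2}`, both scales) in THIS
file: the range `L^{−2} < t ≤ 1` of print's `|x − x′| ≤ ξ` is covered by the sup entry (2.136)₃ (`…B6Prop26DivLegKLevelV1`) at both points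
(`|f(x) − f(x′)| ≤ |f(x)| + |f(x′)|`, `1 ≤ L³t^α`) in the sequel `…B6Prop26HolderDivCensusV1`; `α < 1` as in print (the member constant `C_E(α) → ∞` as
`α → 1`).  (3) The cut-off `ζ` of `‖ζG∇*J‖_α` is put on by the product rule (p22's `abs_cutoff_pair_le`) from this pair bound and (2.136)₃ — not repeated.
(4) Setting as in the imported files (V1 torus, `k ≥ 2`, `M_h = Lᵃ ≥ 8`, `R ≥ 2L²`, `P′ ≥ 5`, odd `L ≥ 5`, cubes placed, global band, Lemma-2.1 and
level-gap budgets); constants on `d, L, b₀, b₁, σ, α, N₀`, not optimised.  Integer tori, lattice units; nothing on d = 4 specifically or the continuum;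
NOT summit progress.  Unit `lit-balaban-p38` (gen 32; gen 34: walk/Hölder exponents decoupled, threshold before `α`), 2026-08-24.
-/

open scoped BigOperators
open Finset

namespace Literature.MathematicalPhysics.QuantumFieldTheory.Balaban1983to89.B6Prop26HolderDivAdmissibleV1

open LatticeFieldCalculus
open B6MultiLevelBoxOperator (N0 bigSide one_le_bigSide)
open B6MultiLevelTorusOperator (TDomains)
open B6Cover236MultiLevelBlocks (cubes)
open B6Geom246MultiLevelBox (bset)
open B6Geom246MultiLevelTorus (geomT)
open B8Ineq192MultiLevelTorus (geomT_len geomTB geomTB_len)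
open B6Eq238MultiLevelTorus (svec)
open B6RandomWalk (HasMajorant hasMajorant_mono)
open B6Ineq2133TwoScaleV1 (onFun)
open B6GlobalChartV1 (PV domT blkV1)
open B6SectAOperatorsV1 (BondIdx)
open B6SectAVectorModelV1 (GE)
open B6AgreeLapV1Chart (cB eB)
open B6Partition118KLevelTorusCentral (one_le_of_four_le)
open B6Partition118KLevelFineSizes (C1F C1F_nonneg)
open B6Prop26KLevelSkeletonV1 (hB ST mem_ST pref pref_nonneg blkV1_mem_QT_of_hB_ne_zero)
open B6Prop26KLevelAssemblyV1 (distT_nonneg)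
open B6CubeWindowV1 (x0 j0 tC tC_j hx0 hfit wC Placed Gl GlobalBand band_le j0_le_level one_le_of_eight_le four_le_of_five_le)
open B6Eq292MemberTorusV1 (EC)
open B6InDecayWindowV1 (OutMajorant outMajorant_mono)
open B6TranslateTorusV1 (vch)
open B6CubeCoeffSizesV1 (level_le_of_mem_QT)
open B6HolderPairMemberV1 (pairOp)
open B6CubePairOutDecayV1 (hHGout_cube hHGEout_cube)
open B6HolderPairWindowV1 (pair_window mem_W_of_deep_one)
open B6HolderPairPlacementV1 (blkV1_mem_ST_of_hB_ne_zero_of_supDist_le)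
open B6HBDisplacementLipV1 (abs_hB_sub_le_supDist)
open B6Prop26HolderDivKLevelV1 (prop26_2137_div_kLevel_of_pairInputs)
open B6Prop26DivLegKLevelV1 (hasMajorant_len_transport)
open B6LapLegKLevelV1 (DVa)

variable {d ℓ : ℕ} {hd : 1 ≤ d + 1} {hL : Odd (ℓ + 1) ∧ 1 < ℓ + 1} {m K : ℕ} {Mh k R : ℕ} {P' : Fin (d + 1) → ℕ}

/-! ## §1  Two elementary facts on real powers -/

/-- `t ≤ t^α` for `t ∈ [0,1]`, `α ∈ [0,1]`. [folklore] -/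
private theorem le_rpow_self {t α : ℝ} (ht0 : 0 ≤ t) (ht1 : t ≤ 1) (hα0 : 0 ≤ α) (hα1 : α ≤ 1) : t ≤ t ^ α := by
  have := Real.rpow_le_rpow_of_exponent_ge' ht0 ht1 hα0 hα1
  rwa [Real.rpow_one] at this

/-- `(Bt)^α ≤ B·t^α` for `B ≥ 1`, `t ≥ 0`, `α ≤ 1`. [folklore] -/
private theorem mul_rpow_le {B t α : ℝ} (hB : 1 ≤ B) (ht0 : 0 ≤ t) (hα1 : α ≤ 1) : (B * t) ^ α ≤ B * t ^ α := by
  rw [Real.mul_rpow (zero_le_one.trans hB) ht0]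
  refine mul_le_mul_of_nonneg_right ?_ (Real.rpow_nonneg ht0 α)
  have := Real.rpow_le_rpow_of_exponent_le hB hα1
  rwa [Real.rpow_one] at this

/-- `x − 0 = x` for bonds. [folklore] -/
private theorem translate_zero' (x : PBond (PV d ℓ m K hd hL) 0) : x.translate 0 = x := by
  cases x; simp [PBond.translate]

/-! ## §2  (2.137)₂ at k levels for near admissible pairs -/

set_option maxHeartbeats 1600000 in
open Classical in
/-- **PROPOSITION 2.6 (2.137)₂ `‖ζG∇*J‖_α` AT k LEVELS FOR THE GENUINE `G = Δ_a⁻¹`, NEAR ADMISSIBLE PAIRS, NO DISPLAYED HYPOTHESIS** (input-block prefactor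
form; the Lemma-2.1 exponent `α_W` of the walk and the Hölder exponent `α` are SEPARATE parameters, the threshold `M₁` is chosen before `α`).  For the
weight band there is `σ₀ > 0` such that for all `0 < σ ≤ σ₀`, `0 ≤ α_W ≤ 1`, `N₀ > 0` and every transport budget `τ_b ∈ [0, 2σ]` there is `M₁ > 0`, and
then for every `0 ≤ α < 1` an `A ≥ 0`, with: on every admissible V1 torus (`k ≥ 2`, `M_h = Lᵃ ≥ 8`, `R ≥ 2L²`, `P′ ≥ 5`, `L ≥ 5`, cubes placed,
`M₁ ≤ L·M_h`, `N₀ + 1 ≤ R·L·M_h`, `e^{−α_Wσ}L^{2(d+1)/N₀} < 1`, `2 log L ≤ τ_b(R·L·M_h − 1)`), for every `c′ ≠ 0`, positive weights in the global band,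
direction `ν` and every pair of fine bonds `(x, x′)` with `x.dir = x′.dir`, `|x − x′|_∞ ≤ L^{j(y(x))−2}` and `|x − x′|_∞ ≤ L^{j(y(x′))−2}`:
`HasMajorant (P_{x,x′}·G·∇*_ν) (A·(|x − x′|_∞/L^{j(y(x))})^α·(L^{j(y′)}|c′|⁻¹)·e^{−(1−α_W)σ d_T(y,y′)})` — pointwise, for `J` supported in `B(y′)`:
`|(G∇*_νJ)(x) − (G∇*_νJ)(x′)| ≤ A·(|x − x′|_∞/L^{j(y(x))})^α·L^{j(y′)}|c′|⁻¹·e^{−(1−α_W)σd_T(y(x),y′)}·|J|`, print's `O(1)(Lʲη)^{1−α}|x − x′|^α e^{−δ₃d(y,y′)}|J|`.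
[cite: Balaban1984PropagatorsII, Prop. 2.6 (2.137) p.247 (second member), (2.141) p.247, (2.133)–(2.135) p.247, (2.88)–(2.94) pp.238–239, (2.36) p.229,
Lemma 2.1 p.234; Balaban1984PropagatorsI, (1.109), (1.111) p.35] -/
theorem prop26_2137_div_kLevel_near (d ℓ : ℕ) (hd : 1 ≤ d + 1) (hL : Odd (ℓ + 1) ∧ 1 < ℓ + 1) {b₀ b₁ : ℝ} (hb₀ : 0 < b₀) (hb₁ : b₀ ≤ b₁) :
    ∃ σ₀ : ℝ, 0 < σ₀ ∧ ∀ (σ : ℝ), 0 < σ → σ ≤ σ₀ → ∀ (αW : ℝ), 0 ≤ αW → αW ≤ 1 → ∀ (N₀ : ℕ), 0 < N₀ →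
    ∀ {τb : ℝ}, 0 ≤ τb → τb ≤ 2 * σ →
    ∃ M₁ : ℝ, 0 < M₁ ∧ ∀ (α : ℝ), 0 ≤ α → α < 1 → ∃ A : ℝ, 0 ≤ A ∧
    ∀ (m K : ℕ) {Mh k R : ℕ} {P' : Fin (d + 1) → ℕ}
      (hN : ∀ μ, N0 ℓ Mh k P' μ = (PV d ℓ m K hd hL).sitesPerDir 0) (D : TDomains d ℓ Mh k P' R) (hk : k ≤ m + K) (_ : 2 ≤ k)
      {a : ℕ} (hMha : Mh = (ℓ + 1) ^ a) (hM8 : 8 ≤ Mh) (_ : 2 * (ℓ + 1) ^ 2 ≤ R) (hP5 : ∀ μ, 5 ≤ P' μ) (_ : 4 ≤ ℓ)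
      (hpl : ∀ c : ↥(cubes D.toDomains), Placed ℓ k P' c.1)
      (_ : M₁ ≤ ((ℓ : ℝ) + 1) * Mh) (_ : N₀ + 1 ≤ R * ((ℓ + 1) * Mh))
      (_ : Real.exp (-(αW * σ)) * ((ℓ : ℝ) + 1) ^ ((2 * (d + 1 : ℕ) : ℝ) / N₀) < 1)
      (_ : 2 * Real.log ((ℓ : ℝ) + 1) ≤ τb * (((R * ((ℓ + 1) * Mh) - 1 : ℕ)) : ℝ))
      {cf : ℝ} (hcf : cf ≠ 0) {w : BondIdx (domT hN D hk) → ℝ} (hw : ∀ i, 0 < w i) (_ : GlobalBand b₀ b₁ cf w) (ν : Fin (d + 1))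
      (x x' : PBond (PV d ℓ m K hd hL) 0) (_ : x.dir = x'.dir)
      (_ : supDist x.src x'.src ≤ (ℓ + 1) ^ ((blkV1 hN D x).1.1 - 2)) (_ : supDist x.src x'.src ≤ (ℓ + 1) ^ ((blkV1 hN D x').1.1 - 2)),
      HasMajorant (g := geomT D) (blkV1 hN D) (pairOp x x' * onFun (GE (domT hN D hk) hcf hw) * DVa ν cf)
        (fun y y' => A * (((supDist x.src x'.src : ℕ) : ℝ) / (((ℓ + 1 : ℕ) : ℝ)) ^ (blkV1 hN D x).1.1) ^ α * ((geomT D).len y' * |cf|⁻¹) *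
          Real.exp (-((1 - αW) * σ * (geomT D).dist y y'))) := by
  have ha₀ : (0 : ℝ) < b₀ / ((ℓ + 1 : ℕ) : ℝ) := by positivity
  obtain ⟨σ5, hσ5, h5⟩ := prop26_2137_div_kLevel_of_pairInputs d ℓ hd hL hb₀ hb₁
  obtain ⟨δH, hδH, CH, hCH, hHG⟩ := hHGout_cube d ℓ hd hL ha₀ (band_le (d := d) (ℓ := ℓ) hb₀ hb₁)
  obtain ⟨δE, hδE, hHGEα⟩ := hHGEout_cube d ℓ hd hL ha₀ (band_le (d := d) (ℓ := ℓ) hb₀ hb₁)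
  have hC1 := C1F_nonneg d ℓ
  refine ⟨min σ5 (min δH δE / 3), lt_min hσ5 (by positivity), ?_⟩
  intro σ hσ0 hσle αW hαW0 hαW1 N₀ hN₀ τb hτb hτb2
  obtain ⟨A₁, A₂, A₃, M₁, hA₁, hA₂, hA₃, hM₁, h5'⟩ := h5 σ hσ0 (hσle.trans (min_le_left _ _)) αW hαW0 hαW1 N₀ hN₀ hτb hτb2
  have hρ' : 3 * σ ≤ min δH δE := by linarith [hσle.trans (min_le_right _ _)]
  obtain ⟨L2, hL2⟩ : ∃ t : ℝ, (((ℓ + 1 : ℕ) : ℝ)) ^ 2 = t := ⟨_, rfl⟩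
  have hL21 : 1 ≤ L2 := by rw [← hL2]; exact_mod_cast Nat.one_le_pow _ _ (Nat.succ_pos ℓ)
  have hL20 : 0 ≤ L2 := zero_le_one.trans hL21
  refine ⟨M₁, hM₁, fun α hα0 hα1 => ?_⟩
  obtain ⟨CE, hCE, hHGE⟩ := hHGEα α hα0 hα1
  refine ⟨A₁ * (CE * L2) + A₂ * (CH * L2) + A₃ * (((d : ℝ) + 1) * C1F d ℓ), by positivity, ?_⟩
  intro m K Mh k R P' hN D hk hk2 a hMha hM8 hR2 hP5 hℓ hpl hLM hRM hθ habs cf hcf w hw hwb ν x x' hdir hnear hnear'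
  have hMh1 : 1 ≤ Mh := one_le_of_eight_le hM8
  have hP4 : ∀ μ, 4 ≤ P' μ := four_le_of_five_le hP5
  have hMh : 2 ≤ Mh := le_trans (by norm_num) hM8
  have hR : 2 * (ℓ + 1) ≤ R := le_trans (by nlinarith : 2 * (ℓ + 1) ≤ 2 * (ℓ + 1) ^ 2) hR2
  have hdnn : ∀ y y' : (geomT D).Site, 0 ≤ (geomT D).dist y y' := distT_nonneg
  have hL1 : (1 : ℝ) ≤ ((ℓ + 1 : ℕ) : ℝ) := by exact_mod_cast Nat.succ_le_succ (Nat.zero_le ℓ)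
  have hL0 : (0 : ℝ) < ((ℓ + 1 : ℕ) : ℝ) := by positivity
  -- the Hölder parameter `t = |x − x′|_∞ / L^{j(y(x))} ∈ [0, 1]`
  obtain ⟨sd, hsd⟩ : ∃ s : ℕ, supDist x.src x'.src = s := ⟨_, rfl⟩
  rw [hsd] at hnear hnear' ⊢
  set t : ℝ := ((sd : ℕ) : ℝ) / (((ℓ + 1 : ℕ) : ℝ)) ^ (blkV1 hN D x).1.1 with ht
  have hpx : (0 : ℝ) < (((ℓ + 1 : ℕ) : ℝ)) ^ (blkV1 hN D x).1.1 := by positivity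
  have ht0 : 0 ≤ t := by positivity
  have ht1 : t ≤ 1 := by
    rw [ht, div_le_one hpx]
    have h1 : sd ≤ (ℓ + 1) ^ (blkV1 hN D x).1.1 := hnear.trans (Nat.pow_le_pow_right (Nat.succ_pos ℓ) (Nat.sub_le _ _))
    exact_mod_cast h1
  have htα : t ≤ t ^ α := le_rpow_self ht0 ht1 hα0 hα1.le
  have htα0 : 0 ≤ t ^ α := Real.rpow_nonneg ht0 α
  have hsdt : ((sd : ℕ) : ℝ) = t * (((ℓ + 1 : ℕ) : ℝ)) ^ (blkV1 hN D x).1.1 := by rw [ht, div_mul_cancel₀ _ hpx.ne']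
  -- ### per-cube geometry of the pair
  have hlev : ∀ (c : ↥(cubes D.toDomains)) (y : ↥(bset D.toDomains)), y ∈ ST D hMh1 hP4 c → y.1.1 ≤ j0 hMh1 hP4 c + 2 := by
    intro c y hy
    have h1 := level_le_of_mem_QT hMh1 hP4 c hR ((mem_ST D hMh1 hP4 c y).1 hy)
    have h2 := (j0_le_level (D := D) (hMh1 := hMh1) (hP4 := hP4) (c := c) hL hR2).2
    omega
  have hST : ∀ c : ↥(cubes D.toDomains), hB hN D c x ≠ 0 ∨ hB hN D c x' ≠ 0 → blkV1 hN D x ∈ ST D hMh1 hP4 c := by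
    intro c hne
    rcases hne with h | h
    · exact (mem_ST D hMh1 hP4 c _).2 (blkV1_mem_QT_of_hB_ne_zero hN D hMh hR hP4 c h)
    · have hx' : blkV1 hN D x' ∈ ST D hMh1 hP4 c := (mem_ST D hMh1 hP4 c _).2 (blkV1_mem_QT_of_hB_ne_zero hN D hMh hR hP4 c h)
      have hl := hlev c _ hx'
      refine blkV1_mem_ST_of_hB_ne_zero_of_supDist_le hN D hM8 hR2 hP5 c h ?_
      rw [hsd]
      exact hnear'.trans (Nat.pow_le_pow_right (Nat.succ_pos ℓ) (by omega))
  have hsdj : ∀ c : ↥(cubes D.toDomains), hB hN D c x ≠ 0 ∨ hB hN D c x' ≠ 0 → sd ≤ (ℓ + 1) ^ j0 hMh1 hP4 c := by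
    intro c hne
    rcases hne with h | h
    · have hl := hlev c _ ((mem_ST D hMh1 hP4 c _).2 (blkV1_mem_QT_of_hB_ne_zero hN D hMh hR hP4 c h))
      exact hnear.trans (Nat.pow_le_pow_right (Nat.succ_pos ℓ) (by omega))
    · have hl := hlev c _ ((mem_ST D hMh1 hP4 c _).2 (blkV1_mem_QT_of_hB_ne_zero hN D hMh hR hP4 c h))
      exact hnear'.trans (Nat.pow_le_pow_right (Nat.succ_pos ℓ) (by omega))
  -- `|x − x′|/L^{j₀(□)} ≤ L²·t` on the active cubes (`j(y(x)) ≤ j₀ + 2`)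
  have hratio : ∀ c : ↥(cubes D.toDomains), hB hN D c x ≠ 0 ∨ hB hN D c x' ≠ 0 →
      ((sd : ℕ) : ℝ) / (((ℓ + 1 : ℕ) : ℝ)) ^ j0 hMh1 hP4 c ≤ L2 * t := by
    intro c hne
    have hl := hlev c _ (hST c hne)
    have hpj : (0 : ℝ) < (((ℓ + 1 : ℕ) : ℝ)) ^ j0 hMh1 hP4 c := by positivity
    rw [div_le_iff₀ hpj, hsdt, ← hL2]
    have hpow : (((ℓ + 1 : ℕ) : ℝ)) ^ (blkV1 hN D x).1.1 ≤ (((ℓ + 1 : ℕ) : ℝ)) ^ (j0 hMh1 hP4 c + 2) := pow_le_pow_right₀ hL1 hl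
    calc t * (((ℓ + 1 : ℕ) : ℝ)) ^ (blkV1 hN D x).1.1 ≤ t * (((ℓ + 1 : ℕ) : ℝ)) ^ (j0 hMh1 hP4 c + 2) := mul_le_mul_of_nonneg_left hpow ht0
      _ = (((ℓ + 1 : ℕ) : ℝ)) ^ 2 * t * (((ℓ + 1 : ℕ) : ℝ)) ^ j0 hMh1 hP4 c := by ring
  -- ### (i) the displacement size of `h_□`: `|h_□(x) − h_□(x′)| ≤ (d+1)·C1F·t^α`
  have hLip : ∀ c : ↥(cubes D.toDomains), |hB hN D c x - hB hN D c x'| ≤ ((d : ℝ) + 1) * C1F d ℓ * t ^ α := by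
    intro c
    by_cases hne : hB hN D c x ≠ 0 ∨ hB hN D c x' ≠ 0
    · have h1 := abs_hB_sub_le_supDist hN D c hMh hR hP5 hdir
      rw [hsd] at h1
      have hl : (blkV1 hN D x).1.1 ≤ c.1.1 + 1 := level_le_of_mem_QT hMh1 hP4 c hR ((mem_ST D hMh1 hP4 c _).1 (hST c hne))
      have hS : (((ℓ + 1 : ℕ) : ℝ)) ^ (blkV1 hN D x).1.1 ≤ (bigSide ℓ Mh c.1.1 : ℝ) := by
        unfold bigSide; push_cast
        have hp : ((ℓ : ℝ) + 1) ^ (blkV1 hN D x).1.1 ≤ ((ℓ : ℝ) + 1) ^ (c.1.1 + 1) := pow_le_pow_right₀ (by linarith) hl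
        have hM : (1 : ℝ) ≤ Mh := by exact_mod_cast hMh1
        have hp0 : (0 : ℝ) ≤ ((ℓ : ℝ) + 1) ^ (c.1.1 + 1) := by positivity
        exact hp.trans (le_mul_of_one_le_left hp0 hM)
      have hS0 : (0 : ℝ) < (bigSide ℓ Mh c.1.1 : ℝ) := lt_of_lt_of_le hpx hS
      have hq : ((sd : ℕ) : ℝ) / (bigSide ℓ Mh c.1.1 : ℝ) ≤ t := by
        rw [ht]; exact div_le_div_of_nonneg_left (by positivity) hpx hS
      calc |hB hN D c x - hB hN D c x'| ≤ ((d : ℝ) + 1) * ((sd : ℕ) : ℝ) * (C1F d ℓ / (8 / 5 * (bigSide ℓ Mh c.1.1 : ℝ))) := h1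
        _ = ((d : ℝ) + 1) * C1F d ℓ * (5 / 8) * (((sd : ℕ) : ℝ) / (bigSide ℓ Mh c.1.1 : ℝ)) := by
            field_simp
        _ ≤ ((d : ℝ) + 1) * C1F d ℓ * (5 / 8) * t := mul_le_mul_of_nonneg_left hq (by positivity)
        _ ≤ ((d : ℝ) + 1) * C1F d ℓ * 1 * t ^ α := by
            gcongr
            norm_num
        _ = ((d : ℝ) + 1) * C1F d ℓ * t ^ α := by ring
    · have hx0 : hB hN D c x = 0 := by
        by_contra h0
        exact hne (Or.inl h0)
      have hx'0 : hB hN D c x' = 0 := by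
        by_contra h0
        exact hne (Or.inr h0)
      rw [hx0, hx'0, sub_zero, abs_zero]; positivity
  -- ### (iii) the pair inputs of the cubes, from the window geometry and the chart-frame members
  have hpairIn : ∀ c : ↥(cubes D.toDomains), hB hN D c x ≠ 0 ∨ hB hN D c x' ≠ 0 → OutMajorant (g := geomT D) (blkV1 hN D)
      (pairOp x x' * Gl hN hk hMh1 hP4 hMha c (band_le (d := d) (ℓ := ℓ) hb₀ hb₁) (hpl c) w cf) (ST D hMh1 hP4 c)
      (fun y y'' => CH * L2 * t ^ α * pref cf y * Real.exp (-(min δH δE * (geomT D).dist y y''))) := by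
    intro c hne
    have hact : hB hN D c x ≠ 0 ∨ hB hN D c ⟨x.src.shift ν, x.dir⟩ ≠ 0 ∨ hB hN D c x' ≠ 0 ∨ hB hN D c ⟨x'.src.shift ν, x'.dir⟩ ≠ 0 :=
      hne.elim Or.inl (fun h => Or.inr (Or.inr (Or.inl h)))
    have hdist1 : supDist x.src x'.src ≤ (ℓ + 1) ^ (j0 hMh1 hP4 c + 1) := by
      rw [hsd]; exact (hsdj c hne).trans (Nat.pow_le_pow_right (Nat.succ_pos ℓ) (Nat.le_succ _))
    obtain ⟨hd1, hd2, hsd'⟩ := pair_window hN hk hMh1 hP4 hMha c (band_le (d := d) (ℓ := ℓ) hb₀ hb₁) hM8 hR2 (hpl c) w cf ν hact hdist1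
    have hW1 := (mem_W_of_deep_one hN hk hMh1 hP4 hMha c (band_le (d := d) (ℓ := ℓ) hb₀ hb₁) (hpl := hpl c) hd1 ν).1
    have hW2 := (mem_W_of_deep_one hN hk hMh1 hP4 hMha c (band_le (d := d) (ℓ := ℓ) hb₀ hb₁) (hpl := hpl c) hd2 ν).1
    have hdir' : (x.translate (-vch Mh k (svec ℓ k c.1.1 c.1.2))).dir = (x'.translate (-vch Mh k (svec ℓ k c.1.1 c.1.2))).dir := by
      rw [PBond.translate_dir, PBond.translate_dir]; exact hdir
    rw [hsd] at hsd'
    have hle' := hsd'.trans (hsdj c hne)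
    have hG := hHG m K hN D hk hMh1 hP4 hMha hMh hR2 hℓ c (hpl c) w cf _ _ hW1 hW2 hdir' hle'
    rw [PBond.translate_translate, PBond.translate_translate, neg_add_cancel, translate_zero', translate_zero'] at hG
    refine outMajorant_mono _ hG fun y _ y'' => ?_
    have hp := pref_nonneg cf y
    have hq : ((supDist (eB (tC hN hk hMh1 hP4 c (band_le (d := d) (ℓ := ℓ) hb₀ hb₁) a (wC hN hk c w) cf) (x0 ℓ Mh k c.1)
          (x.translate (-vch Mh k (svec ℓ k c.1.1 c.1.2)))).src
        (eB (tC hN hk hMh1 hP4 c (band_le (d := d) (ℓ := ℓ) hb₀ hb₁) a (wC hN hk c w) cf) (x0 ℓ Mh k c.1)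
          (x'.translate (-vch Mh k (svec ℓ k c.1.1 c.1.2)))).src : ℕ) : ℝ) /
        (((ℓ + 1 : ℕ) : ℝ)) ^ (tC hN hk hMh1 hP4 c (band_le (d := d) (ℓ := ℓ) hb₀ hb₁) a (wC hN hk c w) cf).j ≤ L2 * t ^ α := by
      rw [tC_j]
      refine le_trans ?_ ((hratio c hne).trans (mul_le_mul_of_nonneg_left htα hL20))
      exact div_le_div_of_nonneg_right (by exact_mod_cast hsd') (by positivity)
    have he : Real.exp (-(δH * (geomT D).dist y y'')) ≤ Real.exp (-(min δH δE * (geomT D).dist y y'')) :=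
      Real.exp_le_exp.2 (neg_le_neg (mul_le_mul_of_nonneg_right (min_le_left _ _) (hdnn y y'')))
    calc CH * (((supDist (eB (tC hN hk hMh1 hP4 c (band_le (d := d) (ℓ := ℓ) hb₀ hb₁) a (wC hN hk c w) cf) (x0 ℓ Mh k c.1)
            (x.translate (-vch Mh k (svec ℓ k c.1.1 c.1.2)))).src
          (eB (tC hN hk hMh1 hP4 c (band_le (d := d) (ℓ := ℓ) hb₀ hb₁) a (wC hN hk c w) cf) (x0 ℓ Mh k c.1)
            (x'.translate (-vch Mh k (svec ℓ k c.1.1 c.1.2)))).src : ℕ) : ℝ) /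
          (((ℓ + 1 : ℕ) : ℝ)) ^ (tC hN hk hMh1 hP4 c (band_le (d := d) (ℓ := ℓ) hb₀ hb₁) a (wC hN hk c w) cf).j) * pref cf y *
          Real.exp (-(δH * (geomT D).dist y y''))
        ≤ CH * (L2 * t ^ α) * pref cf y * Real.exp (-(min δH δE * (geomT D).dist y y'')) := by gcongr
      _ = CH * L2 * t ^ α * pref cf y * Real.exp (-(min δH δE * (geomT D).dist y y'')) := by ring
  have hpairEIn : ∀ (c : ↥(cubes D.toDomains)) (e : Fin (d + 1) × Bool), hB hN D c x ≠ 0 ∨ hB hN D c x' ≠ 0 →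
      OutMajorant (g := geomT D) (blkV1 hN D)
        (pairOp x x' * (Gl hN hk hMh1 hP4 hMha c (band_le (d := d) (ℓ := ℓ) hb₀ hb₁) (hpl c) w cf *
          EC hN hk hMh1 hP4 hMha c (band_le (d := d) (ℓ := ℓ) hb₀ hb₁) (hpl c) w cf e)) (ST D hMh1 hP4 c)
        (fun y y'' => CE * L2 * t ^ α * pref cf y * Real.exp (-(min δH δE * (geomT D).dist y y''))) := by
    intro c e hne
    have hact : hB hN D c x ≠ 0 ∨ hB hN D c ⟨x.src.shift ν, x.dir⟩ ≠ 0 ∨ hB hN D c x' ≠ 0 ∨ hB hN D c ⟨x'.src.shift ν, x'.dir⟩ ≠ 0 :=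
      hne.elim Or.inl (fun h => Or.inr (Or.inr (Or.inl h)))
    have hdist1 : supDist x.src x'.src ≤ (ℓ + 1) ^ (j0 hMh1 hP4 c + 1) := by
      rw [hsd]; exact (hsdj c hne).trans (Nat.pow_le_pow_right (Nat.succ_pos ℓ) (Nat.le_succ _))
    obtain ⟨hd1, hd2, hsd'⟩ := pair_window hN hk hMh1 hP4 hMha c (band_le (d := d) (ℓ := ℓ) hb₀ hb₁) hM8 hR2 (hpl c) w cf ν hact hdist1
    have hW1 := (mem_W_of_deep_one hN hk hMh1 hP4 hMha c (band_le (d := d) (ℓ := ℓ) hb₀ hb₁) (hpl := hpl c) hd1 ν).1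
    have hW2 := (mem_W_of_deep_one hN hk hMh1 hP4 hMha c (band_le (d := d) (ℓ := ℓ) hb₀ hb₁) (hpl := hpl c) hd2 ν).1
    have hdir' : (x.translate (-vch Mh k (svec ℓ k c.1.1 c.1.2))).dir = (x'.translate (-vch Mh k (svec ℓ k c.1.1 c.1.2))).dir := by
      rw [PBond.translate_dir, PBond.translate_dir]; exact hdir
    rw [hsd] at hsd'
    have hle' := hsd'.trans (hsdj c hne)
    have hG := hHGE m K hN D hk hMh1 hP4 hMha hMh hR2 hℓ c (hpl c) w cf e _ _ hW1 hW2 hdir' hle'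
    rw [PBond.translate_translate, PBond.translate_translate, neg_add_cancel, translate_zero', translate_zero'] at hG
    refine outMajorant_mono _ hG fun y _ y'' => ?_
    have hp := pref_nonneg cf y
    have hs0 : 0 ≤ ((supDist (eB (tC hN hk hMh1 hP4 c (band_le (d := d) (ℓ := ℓ) hb₀ hb₁) a (wC hN hk c w) cf) (x0 ℓ Mh k c.1)
          (x.translate (-vch Mh k (svec ℓ k c.1.1 c.1.2)))).src
        (eB (tC hN hk hMh1 hP4 c (band_le (d := d) (ℓ := ℓ) hb₀ hb₁) a (wC hN hk c w) cf) (x0 ℓ Mh k c.1)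
          (x'.translate (-vch Mh k (svec ℓ k c.1.1 c.1.2)))).src : ℕ) : ℝ) /
        (((ℓ + 1 : ℕ) : ℝ)) ^ (tC hN hk hMh1 hP4 c (band_le (d := d) (ℓ := ℓ) hb₀ hb₁) a (wC hN hk c w) cf).j := by positivity
    have hq : (((supDist (eB (tC hN hk hMh1 hP4 c (band_le (d := d) (ℓ := ℓ) hb₀ hb₁) a (wC hN hk c w) cf) (x0 ℓ Mh k c.1)
          (x.translate (-vch Mh k (svec ℓ k c.1.1 c.1.2)))).src
        (eB (tC hN hk hMh1 hP4 c (band_le (d := d) (ℓ := ℓ) hb₀ hb₁) a (wC hN hk c w) cf) (x0 ℓ Mh k c.1)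
          (x'.translate (-vch Mh k (svec ℓ k c.1.1 c.1.2)))).src : ℕ) : ℝ) /
        (((ℓ + 1 : ℕ) : ℝ)) ^ (tC hN hk hMh1 hP4 c (band_le (d := d) (ℓ := ℓ) hb₀ hb₁) a (wC hN hk c w) cf).j) ^ α ≤ L2 * t ^ α := by
      have h1 : ((supDist (eB (tC hN hk hMh1 hP4 c (band_le (d := d) (ℓ := ℓ) hb₀ hb₁) a (wC hN hk c w) cf) (x0 ℓ Mh k c.1)
            (x.translate (-vch Mh k (svec ℓ k c.1.1 c.1.2)))).src
          (eB (tC hN hk hMh1 hP4 c (band_le (d := d) (ℓ := ℓ) hb₀ hb₁) a (wC hN hk c w) cf) (x0 ℓ Mh k c.1)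
            (x'.translate (-vch Mh k (svec ℓ k c.1.1 c.1.2)))).src : ℕ) : ℝ) /
          (((ℓ + 1 : ℕ) : ℝ)) ^ (tC hN hk hMh1 hP4 c (band_le (d := d) (ℓ := ℓ) hb₀ hb₁) a (wC hN hk c w) cf).j ≤ L2 * t := by
        rw [tC_j]
        refine le_trans ?_ (hratio c hne)
        exact div_le_div_of_nonneg_right (by exact_mod_cast hsd') (by positivity)
      exact (Real.rpow_le_rpow hs0 h1 hα0).trans (mul_rpow_le hL21 ht0 hα1.le)
    have he : Real.exp (-(δE * (geomT D).dist y y'')) ≤ Real.exp (-(min δH δE * (geomT D).dist y y'')) :=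
      Real.exp_le_exp.2 (neg_le_neg (mul_le_mul_of_nonneg_right (min_le_right _ _) (hdnn y y'')))
    calc CE * ((((supDist (eB (tC hN hk hMh1 hP4 c (band_le (d := d) (ℓ := ℓ) hb₀ hb₁) a (wC hN hk c w) cf) (x0 ℓ Mh k c.1)
            (x.translate (-vch Mh k (svec ℓ k c.1.1 c.1.2)))).src
          (eB (tC hN hk hMh1 hP4 c (band_le (d := d) (ℓ := ℓ) hb₀ hb₁) a (wC hN hk c w) cf) (x0 ℓ Mh k c.1)
            (x'.translate (-vch Mh k (svec ℓ k c.1.1 c.1.2)))).src : ℕ) : ℝ) /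
          (((ℓ + 1 : ℕ) : ℝ)) ^ (tC hN hk hMh1 hP4 c (band_le (d := d) (ℓ := ℓ) hb₀ hb₁) a (wC hN hk c w) cf).j) ^ α) * pref cf y *
          Real.exp (-(δE * (geomT D).dist y y''))
        ≤ CE * (L2 * t ^ α) * pref cf y * Real.exp (-(min δH δE * (geomT D).dist y y'')) := by gcongr
      _ = CE * L2 * t ^ α * pref cf y * Real.exp (-(min δH δE * (geomT D).dist y y'')) := by ring
  -- ### the assembly `…B6Prop26HolderDivKLevelV1` with `σ_h = (d+1)C1F·t^α`, `τ = C_H L² t^α`, `τ_E = C_E L² t^α`, `ρ′ = min δ_H δ_E`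
  have hmain := h5' m K hN D hk hk2 hMha hM8 hR2 hP5 hℓ hpl hLM hRM hθ habs hcf hw hwb ν x x'
    (sH := ((d : ℝ) + 1) * C1F d ℓ * t ^ α) (τ := CH * L2 * t ^ α) (τE := CE * L2 * t ^ α) (ρ' := min δH δE)
    (by positivity) (by positivity) (by positivity) hρ' hLip (fun c h => hST c (Or.inr h)) hpairIn hpairEIn
  refine hasMajorant_mono _ hmain fun y y' => le_of_eq ?_
  ring

open Classical in
/-- **(2.137)₂ AT k LEVELS FOR NEAR ADMISSIBLE PAIRS, PREFACTOR AT THE OUTPUT BLOCK**: the same with `L^{j(y′)} ≤ L·e^{(τ_b/2)d_T(y,y′)}·L^{j(y)}`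
(the level-gap estimate (2.60) above threshold): `HasMajorant (P_{x,x′}·G·∇*_ν) (A·t^α·L·(L^{j(y)}|c′|⁻¹)·e^{−((1−α_W)σ − τ_b/2)d_T(y,y′)})` — print's
prefactor `(Lʲη)` read at `y = y(x)`; walk exponent `α_W` and Hölder exponent `α` separate, `M₁` before `α`.
[cite: Balaban1984PropagatorsII, Prop. 2.6 (2.137) p.247, (2.60) p.233; Balaban1984PropagatorsI, (1.109) p.35] -/
theorem prop26_2137_div_kLevel_near_out (d ℓ : ℕ) (hd : 1 ≤ d + 1) (hL : Odd (ℓ + 1) ∧ 1 < ℓ + 1) {b₀ b₁ : ℝ} (hb₀ : 0 < b₀) (hb₁ : b₀ ≤ b₁) :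
    ∃ σ₀ : ℝ, 0 < σ₀ ∧ ∀ (σ : ℝ), 0 < σ → σ ≤ σ₀ → ∀ (αW : ℝ), 0 ≤ αW → αW ≤ 1 → ∀ (N₀ : ℕ), 0 < N₀ →
    ∀ {τb : ℝ}, 0 ≤ τb → τb ≤ 2 * σ →
    ∃ M₁ : ℝ, 0 < M₁ ∧ ∀ (α : ℝ), 0 ≤ α → α < 1 → ∃ A : ℝ, 0 ≤ A ∧
    ∀ (m K : ℕ) {Mh k R : ℕ} {P' : Fin (d + 1) → ℕ}
      (hN : ∀ μ, N0 ℓ Mh k P' μ = (PV d ℓ m K hd hL).sitesPerDir 0) (D : TDomains d ℓ Mh k P' R) (hk : k ≤ m + K) (_ : 2 ≤ k)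
      {a : ℕ} (hMha : Mh = (ℓ + 1) ^ a) (hM8 : 8 ≤ Mh) (_ : 2 * (ℓ + 1) ^ 2 ≤ R) (hP5 : ∀ μ, 5 ≤ P' μ) (_ : 4 ≤ ℓ)
      (hpl : ∀ c : ↥(cubes D.toDomains), Placed ℓ k P' c.1)
      (_ : M₁ ≤ ((ℓ : ℝ) + 1) * Mh) (_ : N₀ + 1 ≤ R * ((ℓ + 1) * Mh))
      (_ : Real.exp (-(αW * σ)) * ((ℓ : ℝ) + 1) ^ ((2 * (d + 1 : ℕ) : ℝ) / N₀) < 1)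
      (_ : 2 * Real.log ((ℓ : ℝ) + 1) ≤ τb * (((R * ((ℓ + 1) * Mh) - 1 : ℕ)) : ℝ))
      {cf : ℝ} (hcf : cf ≠ 0) {w : BondIdx (domT hN D hk) → ℝ} (hw : ∀ i, 0 < w i) (_ : GlobalBand b₀ b₁ cf w) (ν : Fin (d + 1))
      (x x' : PBond (PV d ℓ m K hd hL) 0) (_ : x.dir = x'.dir)
      (_ : supDist x.src x'.src ≤ (ℓ + 1) ^ ((blkV1 hN D x).1.1 - 2)) (_ : supDist x.src x'.src ≤ (ℓ + 1) ^ ((blkV1 hN D x').1.1 - 2)),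
      HasMajorant (g := geomT D) (blkV1 hN D) (pairOp x x' * onFun (GE (domT hN D hk) hcf hw) * DVa ν cf)
        (fun y y' => A * (((supDist x.src x'.src : ℕ) : ℝ) / (((ℓ + 1 : ℕ) : ℝ)) ^ (blkV1 hN D x).1.1) ^ α * ((ℓ : ℝ) + 1) *
          ((geomT D).len y * |cf|⁻¹) * Real.exp (-(((1 - αW) * σ - τb / 2) * (geomT D).dist y y'))) := by
  obtain ⟨σ₀, hσ₀, h⟩ := prop26_2137_div_kLevel_near d ℓ hd hL hb₀ hb₁
  refine ⟨σ₀, hσ₀, fun σ hσ0 hσle αW hαW0 hαW1 N₀ hN₀ τb hτb hτb2 => ?_⟩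
  obtain ⟨M₁, hM₁, hα⟩ := h σ hσ0 hσle αW hαW0 hαW1 N₀ hN₀ hτb hτb2
  refine ⟨M₁, hM₁, fun α hα0 hα1 => ?_⟩
  obtain ⟨A, hA, h2⟩ := hα α hα0 hα1
  refine ⟨A, hA, ?_⟩
  intro m K Mh k R P' hN D hk hk2 a hMha hM8 hR2 hP5 hℓ hpl hLM hRM hθ habs cf hcf w hw hwb ν x x' hdir hnear hnear'
  have hMh1 : 1 ≤ Mh := one_le_of_eight_le hM8
  have hP4 : ∀ μ, 4 ≤ P' μ := four_le_of_five_le hP5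
  have hP : ∀ μ, 1 ≤ P' μ := one_le_of_four_le hP4
  have hx := h2 m K hN D hk hk2 hMha hM8 hR2 hP5 hℓ hpl hLM hRM hθ habs hcf hw hwb ν x x' hdir hnear hnear'
  have ht0 : 0 ≤ (((supDist x.src x'.src : ℕ) : ℝ) / (((ℓ + 1 : ℕ) : ℝ)) ^ (blkV1 hN D x).1.1) ^ α := Real.rpow_nonneg (by positivity) α
  have hC : 0 ≤ A * (((supDist x.src x'.src : ℕ) : ℝ) / (((ℓ + 1 : ℕ) : ℝ)) ^ (blkV1 hN D x).1.1) ^ α := mul_nonneg hA ht0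
  have hx' := hasMajorant_len_transport hN hMh1 hP hτb habs hC (inv_nonneg.2 (abs_nonneg cf))
    (hasMajorant_mono _ hx fun y y' => le_of_eq (by rw [geomTB_len, geomT_len]; ring))
  refine hasMajorant_mono _ hx' fun y y' => le_of_eq ?_
  rw [geomTB_len, geomT_len]


end Literature.MathematicalPhysics.QuantumFieldTheory.Balaban1983to89.B6Prop26HolderDivAdmissibleV1
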